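import Summits.QuantumFields.BalabanUV.T4Continuum.Support.B13HistInsertion
import Summits.QuantumFields.BalabanUV.T4Continuum.Support.InsertionLinearRate

/-!
# B13HistInsertionRate — row O1-c (HISTORY ∕ TABLES) of the NE5 crux O1, part 4: run B's finite-rank reading and W4
# (`StepModel.InsertionRate`) for the finite-rank insertion class from ONE age-free kernel RATE, by P2's
# `InsertionLinearRate.LinearPair.insertionRate_of_linear` BY NAME (cell `pub-balaban`, T⁴ fan-out,
# `HOME/t4/b2b-balaban-t4-ne5-p1/O1-CLAIM-TABLE-NE5-P1.md` row O1-c; design `B13StepDesign.md` v0.2 RULES R3, R3′)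

Unit `b2b-balaban-t4-ne5-formalise-leaf-06` (NE5 formalisation swarm, leaf prover 06).  Summits-side NEW WORK under the LEAN
PLACEMENT RULE (cell modelling + bookkeeping; nothing of the manuscripts under audit is asserted).  HONEST FRAMING: rung (B)+1 of the
FINITE-VOLUME T⁴ continuum programme — NOT infinite volume, NOT a mass gap, NOT the Clay problem, NOT a proof of NE5 (NOT PRINTED;
cell GAPS G-t4-U3-1).  HONEST DEPENDENCY (cell line, verbatim): continuum YM on T⁴ ⇐ BetaPertH ∧ nine spine estimates (0/9 proved);
BetaPertH ⇐ (D1) ∧ (D4) ∧ CAP+tail; G-an2-4 gates asym, D1 and NE2/3/4.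

WHAT THIS FILE TYPES (bookkeeping; NO estimate of [II]).  Part 2 (`B13HistInsertion` §2) reads run A's finite-rank insertion
`KernelDatum.linA` AS P2's `InsertionLinearClass.LinearInsertion` with the age factors inside `vec`, and derives W3 from the age-free
kernel BUDGET.  Here the run-B twin and the W4 side:
* `sum_age_le` (`Σ_{j<k} ω^{k−1−j} ≤ (1 − ω)⁻¹`); `KernelDatum.linB` (run B's reading, age factors inside `vec`), `linB_ins` (P2's
  `LinearInsertion.ins` of `linB` IS `InsDatum.insB` of the kernels), `linA_dom_eq_linB_dom` (`rfl` — the `hdom` hypothesis of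
  `LinearPair.insertionRate_of_linear`), `readsB_linB_iff` (P2's `LinearPair.ReadsB K.linB` ⟺ this lineage's `InsDatum.ReadsB`);
* the AGE-FREE kernel RATE binder `KerRate κ δv θ` (NE2-TYPE two-spacing rate of the kernels per scale fibre, displayed; NOT PRINTED —
  node U1a's currency, like every W1∕W4 input of the row) and **`vecRate_of_kerRate`**: `KerRate κ δv θ ∧ 0 ≤ ω < 1` ⟹ P2's
  `LinearPair.VecRate K.linA K.linB M W κ (δv(1 − ω)⁻¹) θ` (the age structure is the class's, the rate is age-free);
* **`insertionRate_of_kernelRates`**: `ReadsA ∧ ReadsB ∧ BaseRate δb θ ∧ KerRate κ δv θ ∧ 0 ≤ ω < 1` ⟹ W4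
  `M.InsertionRate W κ E₀ (δb + E₀·δv(1 − ω)⁻¹) θ` for every level `E₀ ≥ 0` — `LinearPair.insertionRate_of_linear` BY NAME, no
  analyticity, no estimate beyond the two displayed rates.
So an O1 instance built on a `KernelDatum` has BOTH wall producers of the row by name: W3 ⇐ `KerBudget` (part 2), W4 ⇐ `BaseRate` ∧
`KerRate` (here); the alternative W4 producer through analyticity is `OutputRateInsertion.insertionRate_of_insOp` on `toInsOpModel`.
WHAT IS NOT HERE: no estimate of [II]; no claim that Bałaban's insertion is finite-rank (MODELLING NOTE of part 2).  0 sorry; axioms ⊆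
{propext, Classical.choice, Quot.sound}.
-/

noncomputable section

open scoped BigOperators
open Finset

namespace Summit.QuantumFields.BalabanUV.T4Continuum.B13HistInsertionRate

open Literature.MathematicalPhysics.QuantumFieldTheory.Balaban1983to89
open Literature.MathematicalPhysics.QuantumFieldTheory.Balaban1983to89.T4OutputRate (Carriers)
open Literature.MathematicalPhysics.QuantumFieldTheory.Balaban1983to89.T4InputCauchyRateData (StepModel)
open Summit.QuantumFields.BalabanUV.T4Continuum.InsertionLinearClass (LinearInsertion)
open Summit.QuantumFields.BalabanUV.T4Continuum.InsertionLinearRate (LinearPair.ReadsB LinearPair.BaseRate LinearPair.VecRate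
  LinearPair.insertionRate_of_linear)
open Summit.QuantumFields.BalabanUV.T4Continuum.B13HistInsertion

variable {C : Carriers} {IOp Op Hist : Type*} [NormedAddCommGroup Op] [NormedSpace ℂ Op] [NormedAddCommGroup Hist]
  [NormedSpace ℂ Hist]

/-- [folklore] The age-weighted sum of a constant: `Σ_{j<k} ω^{k−1−j} ≤ (1 − ω)⁻¹` for `0 ≤ ω < 1` (geometric tail). -/
theorem sum_age_le {ω : ℝ} (hω : 0 ≤ ω) (hω1 : ω < 1) (k : ℕ) : ∑ j ∈ range k, ω ^ (k - 1 - j) ≤ (1 - ω)⁻¹ := by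
  have hrefl : ∑ j ∈ range k, ω ^ (k - 1 - j) = ∑ m ∈ range k, ω ^ m := Finset.sum_range_reflect (fun m => ω ^ m) k
  rw [hrefl]
  exact sum_le_hasSum _ (fun n _ => pow_nonneg hω n) (hasSum_geometric_of_lt_one hω hω1)

namespace KernelDatum

variable (K : KernelDatum C IOp Hist)

/-- [folklore] Run B's insertion AS P2's `LinearInsertion`, with the age factors inside `vec` (the twin of `KernelDatum.linA`). -/
def linB : LinearInsertion C Hist where
  dom := K.dom
  dom_lt := K.dom_lt
  base g U k := K.base k (K.insOpB g U k)
  vec g U k Y := ((K.ω ^ (k - 1 - C.scale Y) : ℝ) : ℂ) • K.ker k (K.insOpB g U k) Y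

/-- [folklore] P2's `LinearInsertion.ins` of `linB` IS the `InsDatum` insertion `insB` of the kernels. -/
theorem linB_ins (g : ℕ → ℝ) (U : C.BgB) (k : ℕ) (t : C.Dom → ℝ) : (linB K).ins g U k t = K.toInsDatum.insB g U k t := by
  simp only [LinearInsertion.ins, linB, InsDatum.insB, InsDatum.ins, KernelDatum.toInsDatum, KernelDatum.slice]
  congr 1
  rw [K.sum_dom_eq_sum_fibre]
  refine Finset.sum_congr rfl fun j _ => ?_
  rw [Finset.smul_sum]
  refine Finset.sum_congr rfl fun Y hY => ?_
  rw [(Finset.mem_filter.1 hY).2, smul_comm]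

/-- [folklore] The two readings share their domain sets (the `hdom` hypothesis of `LinearPair.insertionRate_of_linear` is `rfl`). -/
theorem linA_dom_eq_linB_dom (k : ℕ) : K.linA.dom k = (linB K).dom k := rfl

/-- [folklore] P2's run-B reading `LinearPair.ReadsB (linB K) M W` IS this lineage's `InsDatum.ReadsB` of the kernels. -/
theorem readsB_linB_iff (M : StepModel C Op Hist) (W : Set (ℕ → ℝ)) :
    LinearPair.ReadsB (linB K) M W ↔ K.toInsDatum.ReadsB M W := by
  simp only [LinearPair.ReadsB, InsDatum.ReadsB, linB_ins]

/-- [folklore] HYPOTHESIS SHAPE `KerRate κ δv θ` (NE2-TYPE two-spacing rate of the AGE-FREE kernels, displayed; NOT PRINTED —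
node U1a's currency): at step `k`, for every `j < k`, the `e^{−κd}`-weighted ℓ¹ discrepancy of the two runs' scale-`j` kernel vectors
is at most `δv·θ^k` history margins. -/
def KerRate (M : StepModel C Op Hist) (W : Set (ℕ → ℝ)) (κ δv θ : ℝ) : Prop :=
  ∀ k, ∀ g ∈ W, ∀ (U : C.BgB) (j : ℕ), j < k →
    ∑ Y ∈ K.fibre k j, Real.exp (-(κ * C.d Y)) * ‖K.ker k (K.insOpA g U k) Y - K.ker k (K.insOpB g U k) Y‖ ≤
      δv * θ ^ k * M.rHist k

variable {K} {M : StepModel C Op Hist} {W : Set (ℕ → ℝ)}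

/-- [folklore] **P2's `VecRate` FROM THE AGE-FREE KERNEL RATE**: `KerRate κ δv θ`, `0 ≤ ω < 1`, `0 ≤ δv`, `0 ≤ θ` ⟹
`LinearPair.VecRate K.linA (linB K) M W κ (δv(1 − ω)⁻¹) θ` (fibre decomposition, the age factor out of each fibre, geometric tail). -/
theorem vecRate_of_kerRate {κ δv θ : ℝ} (hr : KerRate K M W κ δv θ) (hω : 0 ≤ K.ω) (hω1 : K.ω < 1) (hδ : 0 ≤ δv)
    (hθ : 0 ≤ θ) : LinearPair.VecRate K.linA (linB K) M W κ (δv * (1 - K.ω)⁻¹) θ := by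
  intro k g hg U
  have hfib : ∀ j, ∀ Y ∈ K.fibre k j, Real.exp (-(κ * C.d Y)) * ‖K.linA.vec g U k Y - (linB K).vec g U k Y‖ =
      K.ω ^ (k - 1 - j) *
        (Real.exp (-(κ * C.d Y)) * ‖K.ker k (K.insOpA g U k) Y - K.ker k (K.insOpB g U k) Y‖) := fun j Y hY => by
    simp only [KernelDatum.linA, linB, ← smul_sub, norm_smul, Complex.norm_real, Real.norm_eq_abs,
      abs_of_nonneg (pow_nonneg hω _), (Finset.mem_filter.1 hY).2]
    ring
  have hunit : 0 ≤ δv * θ ^ k * M.rHist k := mul_nonneg (mul_nonneg hδ (pow_nonneg hθ _)) (M.rHist_pos k).le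
  calc ∑ Y ∈ K.linA.dom k, Real.exp (-(κ * C.d Y)) * ‖K.linA.vec g U k Y - (linB K).vec g U k Y‖
      = ∑ j ∈ range k, ∑ Y ∈ K.fibre k j, Real.exp (-(κ * C.d Y)) * ‖K.linA.vec g U k Y - (linB K).vec g U k Y‖ :=
        (Finset.sum_fiberwise_of_maps_to (g := C.scale) (fun Y hY => mem_range.2 (K.dom_lt k Y hY)) _).symm
    _ = ∑ j ∈ range k, K.ω ^ (k - 1 - j) *
          ∑ Y ∈ K.fibre k j, Real.exp (-(κ * C.d Y)) * ‖K.ker k (K.insOpA g U k) Y - K.ker k (K.insOpB g U k) Y‖ := by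
        refine Finset.sum_congr rfl fun j _ => ?_
        rw [Finset.mul_sum]
        exact Finset.sum_congr rfl (hfib j)
    _ ≤ ∑ j ∈ range k, K.ω ^ (k - 1 - j) * (δv * θ ^ k * M.rHist k) :=
        Finset.sum_le_sum fun j hj => mul_le_mul_of_nonneg_left (hr k g hg U j (mem_range.1 hj)) (pow_nonneg hω _)
    _ = (∑ j ∈ range k, K.ω ^ (k - 1 - j)) * (δv * θ ^ k * M.rHist k) := by rw [Finset.sum_mul]
    _ ≤ (1 - K.ω)⁻¹ * (δv * θ ^ k * M.rHist k) := mul_le_mul_of_nonneg_right (sum_age_le hω hω1 k) hunit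
    _ = δv * (1 - K.ω)⁻¹ * θ ^ k * M.rHist k := by ring

/-- [folklore] **W4 FOR THE FINITE-RANK CLASS** from the two runs' readings and the two displayed AGE-FREE data rates:
`ReadsA ∧ ReadsB ∧ BaseRate δb θ ∧ KerRate κ δv θ ∧ 0 ≤ ω < 1` ⟹ `M.InsertionRate W κ E₀ (δb + E₀·(δv(1 − ω)⁻¹)) θ` for every
level `E₀ ≥ 0` — P2's `LinearPair.insertionRate_of_linear` BY NAME (triangle inequality only; no analyticity). -/
theorem insertionRate_of_kernelRates {κ E₀ δb δv θ : ℝ} (hA : K.toInsDatum.ReadsA M W) (hB : K.toInsDatum.ReadsB M W)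
    (hbase : LinearPair.BaseRate K.linA (linB K) M W δb θ) (hr : KerRate K M W κ δv θ) (hω : 0 ≤ K.ω) (hω1 : K.ω < 1)
    (hδ : 0 ≤ δv) (hθ : 0 ≤ θ) (hE₀ : 0 ≤ E₀) : M.InsertionRate W κ E₀ (δb + E₀ * (δv * (1 - K.ω)⁻¹)) θ :=
  LinearPair.insertionRate_of_linear ((K.reads_linA_iff M W).2 hA) ((readsB_linB_iff K M W).2 hB)
    (linA_dom_eq_linB_dom K) hbase (vecRate_of_kerRate hr hω hω1 hδ hθ) hE₀

end KernelDatum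

end Summit.QuantumFields.BalabanUV.T4Continuum.B13HistInsertionRate

end
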